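import Literature.NumberTheory.LFunctions.MoebiusWalshCircuitsProofs
import Literature.NumberTheory.Sieve.VinogradovExpSumTools
import Literature.NumberTheory.Sieve.VaughanMeanValueDecomposition
import HarnessLib

/-!
# Geometric-sum majorants along the dyadic frequencies `ak/2^L` (tools for Bourgain 2013, §§2–3) — proved

Topic `Literature/NumberTheory/LFunctions`, sibling of `MoebiusWalshCircuitsProofs.lean`. Everything
here is PROVED (theorems only); no definition, no named fact.

These are the counting estimates that the type-I analysis (§3, (3.2), (3.8)–(3.9): "`∑_{m∼M}
|{k₁ < 2^{λ-2μ} : k₁m ≡ 0 (mod 2^{λ-2μ})}| ≲ μM`") and the type-II analysis (§2, (2.11)–(2.12),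
(2.16)–(2.18), (2.24)) of J. Bourgain, *Möbius–Walsh correlation bounds and an estimate of
Mauduit and Rivat*, J. Anal. Math. 119 (2013) 147–163 = arXiv:1109.2784 [Bourgain2013MoebiusWalsh]
reduce to once the `n`- (or `m`-) summation of `e(kmn/2^λ)` over a dyadic block is bounded by the
geometric-sum majorant `min(V, 1/(2‖θ‖))` (`Literature.NumberTheory.Sieve.Vinogradov.geomBound`):
sums of that majorant along the frequencies `θ_k = ak/2^L + β`. Because all savings in the paper
are powers of `2^{-λ^{1/10}}`, logarithmic losses are harmless and the "smoothened summation" of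
(2.11), (3.2) can be replaced by these sharp-cutoff bounds.

* `one_div_le_distInt_int_div`, `one_div_le_distInt_sub` — `‖p/Q‖ ≥ 1/Q` for `Q ∤ p`; the points
  `r/Q + β` are `1/Q`-separated; hence (`sum_range_geomBound_div_add_le`, from the tree's
  `sum_geomBound_le_of_separated`) `∑_{r<Q} min(V, 1/(2‖r/Q + β‖)) ≤ 2V + Q(1 + log Q)`.
* `sum_range_comp_odd_mul`, `sum_range_comp_two_pow_mul` — multiplication by an odd number
  permutes `ℤ/2^t`, and for `a = 2^s a'` the frequencies `ak/2^{t+s}` run `2^s` times over `r/2^t`.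
* `sum_range_geomBound_mul_div_le` — a full period:
  `∑_{k<2^L} min(V, 1/(2‖ak/2^L + β‖)) ≤ 2^{v₂(a)+1}V + 2^L(1 + log 2^L)` (`a ≠ 0`, `v₂ = factorization 2`);
  `sum_Ico_geomBound_mul_div_le` — any interval of length `N`: multiply by `N/2^L + 2`.
* `sum_dyadic_card_divisors_mul_two_pow_le` —
  `∑_{2^i ≤ a < 2^{i+1}} τ(a)2^{v₂(a)} ≤ (i+1)²2^{i+1}(1 + log 2^{i+1})` (the divisor weight is the
  type-I coefficient `|μ_u ∗ μ_u| ≤ τ` of the Vaughan decomposition for `μ`,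
  `MoebiusWalshVaughan.lean`), via `τ(2^s a') = (s+1)τ(a')` and the tree's
  `Literature.NumberTheory.Sieve.Vaughan.sum_card_divisors_le`.
* `norm_sum_Ico_eChar_le_geomBound` — `|∑_{B₀ ≤ b < B₀+N} e(θb)| ≤ min(N, 1/(2‖θ‖))` in the
  `eChar` normal form of `MoebiusWalshCircuitsProofs.lean` (Nathanson, Lemma 4.7, from the tree).

## References

* J. Bourgain, J. Anal. Math. 119 (2013) 147–163; arXiv:1109.2784, §2 (2.11)–(2.18), (2.24);
  §3 (3.2), (3.8)–(3.9). [Bourgain2013MoebiusWalsh]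
* M. B. Nathanson, *Additive Number Theory: the Classical Bases*, GTM 164, §4.4, Lemmas 4.7–4.9
  (through `VinogradovExpSumTools.lean`). [Nathanson1996]
-/

noncomputable section

open Finset Real

namespace Literature.NumberTheory.LFunctions.MoebiusWalsh

open Literature.NumberTheory.Sieve.Vinogradov (distInt geomBound distInt_nonneg distInt_add_int
  distInt_le_abs_sub_int geomBound_le geomBound_nonneg sum_geomBound_le_of_separated)

/-! ### Rational points with a power-of-two (or any) denominator are well spaced -/

/-- `‖p/Q‖ ≥ 1/Q` when `Q ∤ p`. [folklore] -/
theorem one_div_le_distInt_int_div {Q : ℕ} (hQ : 0 < Q) {p : ℤ} (hp : ¬ (Q : ℤ) ∣ p) :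
    1 / (Q : ℝ) ≤ distInt ((p : ℝ) / Q) := by
  have hQr : (0 : ℝ) < Q := by exact_mod_cast hQ
  unfold distInt
  set n := round ((p : ℝ) / Q) with hn
  have hne : p - n * Q ≠ 0 := fun h => hp ⟨n, by linarith⟩
  have h1 : (1 : ℝ) ≤ |(((p - n * Q : ℤ)) : ℝ)| := by exact_mod_cast Int.one_le_abs hne
  have heq : (p : ℝ) / Q - n = (((p - n * Q : ℤ)) : ℝ) / Q := by push_cast; field_simp
  rw [heq, abs_div, abs_of_pos hQr]
  exact div_le_div_of_nonneg_right h1 hQr.le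

/-- The points `r/Q + β`, `r < Q`, are pairwise `1/Q`-separated modulo `1`. [folklore] -/
theorem one_div_le_distInt_sub {Q : ℕ} {r r' : ℕ} (hr : r < Q) (hr' : r' < Q) (hne : r ≠ r') (β : ℝ) :
    1 / (Q : ℝ) ≤ distInt (((r : ℝ) / Q + β) - ((r' : ℝ) / Q + β)) := by
  have hQ : 0 < Q := by omega
  have h : ((r : ℝ) / Q + β) - ((r' : ℝ) / Q + β) = (((r : ℤ) - r' : ℤ) : ℝ) / Q := by push_cast; ring
  rw [h]
  refine one_div_le_distInt_int_div hQ fun hd => ?_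
  have hlt : |(r : ℤ) - r'| < (Q : ℤ) := by rw [abs_lt]; constructor <;> omega
  have := Int.eq_zero_of_abs_lt_dvd hd hlt
  omega

/-- **A full period of `min(V, 1/(2‖r/Q + β‖))`**: `∑_{r<Q} min(V, 1/(2‖r/Q + β‖)) ≤ 2V + Q(1 + log Q)`
(at most two of the points are within `1/Q` of an integer; the others are `1/Q`-spaced).
[folklore] -/
theorem sum_range_geomBound_div_add_le {Q : ℕ} (hQ : 0 < Q) {V : ℝ} (hV : 0 ≤ V) (β : ℝ) :
    ∑ r ∈ range Q, geomBound V ((r : ℝ) / Q + β) ≤ 2 * V + Q * (1 + Real.log Q) := by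
  have hQr : (0 : ℝ) < Q := by exact_mod_cast hQ
  have h := sum_geomBound_le_of_separated (range Q) (fun r : ℕ => (r : ℝ) / Q + β) (δ := 1 / Q)
    (by positivity) (m := Q) (by rw [show (1 : ℝ) / (2 * (1 / Q)) = Q / 2 by field_simp]; linarith)
    (fun i hi j hj hij => one_div_le_distInt_sub (Finset.mem_range.1 hi) (Finset.mem_range.1 hj) hij β) hV
  rwa [one_div_one_div] at h

/-! ### Periodicity and the odd-multiplier permutation -/

/-- `min(V, 1/(2‖x + n‖)) = min(V, 1/(2‖x‖))` for a natural number `n`. [folklore] -/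
theorem geomBound_add_nat (V x : ℝ) (n : ℕ) : geomBound V (x + n) = geomBound V x := by
  unfold geomBound
  rw [show (x + n : ℝ) = x + ((n : ℤ) : ℝ) by push_cast; ring, distInt_add_int]

/-- Multiplication by an odd number permutes the residues modulo `2^t`:
`∑_{k<2^t} F(a'k/2^t) = ∑_{r<2^t} F(r/2^t)` for `F` invariant under `x ↦ x + n`, `n ∈ ℕ`. [folklore] -/
theorem sum_range_comp_odd_mul {t a' : ℕ} (ha : Odd a') (F : ℝ → ℝ) (hF : ∀ (x : ℝ) (n : ℕ), F (x + n) = F x) :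
    ∑ k ∈ range (2 ^ t), F (((a' * k : ℕ) : ℝ) / 2 ^ t) = ∑ r ∈ range (2 ^ t), F ((r : ℝ) / 2 ^ t) := by
  classical
  have hP : 0 < 2 ^ t := Nat.two_pow_pos t
  -- reduce `a'k` modulo `2^t`
  have hred : ∀ k : ℕ, F (((a' * k : ℕ) : ℝ) / 2 ^ t) = F ((((a' * k) % 2 ^ t : ℕ) : ℝ) / 2 ^ t) := by
    intro k
    conv_lhs => rw [← Nat.mod_add_div (a' * k) (2 ^ t)]
    rw [show ((((a' * k) % 2 ^ t + 2 ^ t * ((a' * k) / 2 ^ t) : ℕ) : ℝ) / 2 ^ t) =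
      ((((a' * k) % 2 ^ t : ℕ) : ℝ) / 2 ^ t) + (((a' * k) / 2 ^ t : ℕ) : ℝ) by push_cast; field_simp, hF]
  simp_rw [hred]
  -- `k ↦ a'k mod 2^t` is a bijection of `range (2^t)`
  have hinj : Set.InjOn (fun k : ℕ => (a' * k) % 2 ^ t) ↑(range (2 ^ t)) := by
    intro k hk k' hk' h
    have hk2 : k < 2 ^ t := Finset.mem_range.1 hk
    have hk2' : k' < 2 ^ t := Finset.mem_range.1 hk'
    have hmod : a' * k ≡ a' * k' [MOD 2 ^ t] := h
    have hcop : Nat.Coprime a' (2 ^ t) := Nat.Coprime.pow_right _ (Nat.coprime_two_right.mpr ha)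
    have h2 : k ≡ k' [MOD 2 ^ t] := Nat.ModEq.cancel_left_of_coprime hcop.symm hmod
    exact Nat.ModEq.eq_of_lt_of_lt h2 hk2 hk2'
  have himage : (range (2 ^ t)).image (fun k : ℕ => (a' * k) % 2 ^ t) = range (2 ^ t) := by
    apply Finset.eq_of_subset_of_card_le
    · intro r hr
      rw [Finset.mem_image] at hr
      obtain ⟨k, -, rfl⟩ := hr
      exact Finset.mem_range.2 (Nat.mod_lt _ hP)
    · rw [Finset.card_image_of_injOn hinj]
  conv_rhs => rw [← himage]
  rw [Finset.sum_image hinj]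

/-- **The `2`-adic reparametrisation**: for `a = 2^s a'` with `a'` odd,
`∑_{k < 2^{t+s}} F(ak/2^{t+s}) = 2^s ∑_{r<2^t} F(r/2^t)` (`F` invariant under natural shifts).
[folklore] -/
theorem sum_range_comp_two_pow_mul {s t a' : ℕ} (ha : Odd a') (F : ℝ → ℝ)
    (hF : ∀ (x : ℝ) (n : ℕ), F (x + n) = F x) :
    ∑ k ∈ range (2 ^ (t + s)), F (((2 ^ s * a' * k : ℕ) : ℝ) / 2 ^ (t + s)) =
      2 ^ s * ∑ r ∈ range (2 ^ t), F ((r : ℝ) / 2 ^ t) := by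
  simp only [pow_add]
  rw [sum_range_mul_eq_sum_sum]
  have hinner : ∀ m ∈ range (2 ^ s), ∑ k ∈ range (2 ^ t), F (((2 ^ s * a' * (k + 2 ^ t * m) : ℕ) : ℝ) /
      (2 ^ t * 2 ^ s)) = ∑ r ∈ range (2 ^ t), F ((r : ℝ) / 2 ^ t) := by
    intro m _
    rw [← sum_range_comp_odd_mul ha F hF]
    refine Finset.sum_congr rfl fun k _ => ?_
    rw [show (((2 ^ s * a' * (k + 2 ^ t * m) : ℕ) : ℝ) / (2 ^ t * 2 ^ s)) =
      ((a' * k : ℕ) : ℝ) / 2 ^ t + ((a' * m : ℕ) : ℝ) by push_cast; field_simp, hF]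
  rw [Finset.sum_congr rfl hinner, Finset.sum_const, Finset.card_range, nsmul_eq_mul]
  push_cast; ring

/-! ### `∑_k min(V, 1/(2‖ak/2^L + β‖))` over a period and over an interval -/

/-- `a = 2^{v₂(a)} a'` with `a'` odd, for `a ≠ 0`. [folklore] -/
theorem exists_eq_two_pow_factorization_mul_odd {a : ℕ} (ha : a ≠ 0) :
    ∃ a' : ℕ, Odd a' ∧ a = 2 ^ (a.factorization 2) * a' := by
  refine ⟨a / 2 ^ (a.factorization 2), ?_, (Nat.ordProj_mul_ordCompl_eq_self a 2).symm⟩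
  have h := Nat.not_dvd_ordCompl Nat.prime_two ha
  rwa [Nat.two_dvd_ne_zero, ← Nat.odd_iff] at h

/-- **A full period**: for `a ≠ 0`,
`∑_{k<2^L} min(V, 1/(2‖ak/2^L + β‖)) ≤ 2^{v₂(a)+1} V + 2^L (1 + log 2^L)`
(the frequencies `ak/2^L mod 1` run `2^{v₂(a)}` times over the multiples of `2^{v₂(a)-L}`).
This is the count behind Bourgain 2013, (3.8)–(3.9) ("`∑_{m∼M} |{k₁ : k₁m ≡ 0 (mod 2^{λ-2μ})}| ≲ μM`")
and (2.16)–(2.18). [cite: Bourgain2013MoebiusWalsh, (3.8)–(3.9)] -/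
theorem sum_range_geomBound_mul_div_le {a : ℕ} (ha : a ≠ 0) (L : ℕ) {V : ℝ} (hV : 0 ≤ V) (β : ℝ) :
    ∑ k ∈ range (2 ^ L), geomBound V (((a * k : ℕ) : ℝ) / 2 ^ L + β) ≤
      2 ^ (a.factorization 2 + 1) * V + 2 ^ L * (1 + Real.log (2 ^ L)) := by
  obtain ⟨a', ha', haeq⟩ := exists_eq_two_pow_factorization_mul_odd ha
  set s := a.factorization 2 with hs
  have hlog : ∀ n : ℕ, 0 ≤ 1 + Real.log (2 ^ n) := fun n => by
    have : 0 ≤ Real.log ((2 : ℝ) ^ n) := Real.log_nonneg (one_le_pow₀ (by norm_num)); linarith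
  rcases le_or_gt s L with hsL | hsL
  · -- `L = t + s`
    obtain ⟨t, rfl⟩ : ∃ t, L = t + s := ⟨L - s, by omega⟩
    rw [haeq]
    have h := sum_range_comp_two_pow_mul (s := s) (t := t) ha' (fun x => geomBound V (x + β))
      (fun x n => by rw [show x + n + β = (x + β) + n by ring, geomBound_add_nat])
    rw [h]
    have hper := sum_range_geomBound_div_add_le (Nat.two_pow_pos t) hV β
    push_cast at hper ⊢
    have h2s : (0 : ℝ) < 2 ^ s := by positivity
    have hlogmono : Real.log ((2 : ℝ) ^ t) ≤ Real.log ((2 : ℝ) ^ (t + s)) :=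
      Real.log_le_log (by positivity) (pow_le_pow_right₀ (by norm_num) (by omega))
    have h2t : (0 : ℝ) ≤ 2 ^ t := by positivity
    calc (2 : ℝ) ^ s * ∑ r ∈ range (2 ^ t), geomBound V ((r : ℝ) / 2 ^ t + β)
        ≤ 2 ^ s * (2 * V + 2 ^ t * (1 + Real.log (2 ^ t))) := mul_le_mul_of_nonneg_left hper h2s.le
      _ ≤ 2 ^ s * (2 * V + 2 ^ t * (1 + Real.log (2 ^ (t + s)))) := by gcongr
      _ = 2 ^ (s + 1) * V + 2 ^ (t + s) * (1 + Real.log (2 ^ (t + s))) := by rw [pow_add, pow_add]; ring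
  · -- `s > L`: every frequency is an integer shift of `β`
    have hterm : ∀ k : ℕ, geomBound V (((a * k : ℕ) : ℝ) / 2 ^ L + β) ≤ V := fun k => geomBound_le _ _
    calc ∑ k ∈ range (2 ^ L), geomBound V (((a * k : ℕ) : ℝ) / 2 ^ L + β)
        ≤ ∑ _k ∈ range (2 ^ L), V := Finset.sum_le_sum fun k _ => hterm k
      _ = 2 ^ L * V := by rw [Finset.sum_const, Finset.card_range, nsmul_eq_mul]; push_cast; ring
      _ ≤ 2 ^ (s + 1) * V := mul_le_mul_of_nonneg_right (pow_le_pow_right₀ (by norm_num) (by omega)) hV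
      _ ≤ 2 ^ (s + 1) * V + 2 ^ L * (1 + Real.log (2 ^ L)) := le_add_of_nonneg_right (by
          have := hlog L; positivity)

/-- **An interval of length `N`**: for `a ≠ 0` and any `n₀`,
`∑_{n₀ ≤ n < n₀+N} min(V, 1/(2‖an/2^L + β‖)) ≤ (N/2^L + 2)(2^{v₂(a)+1} V + 2^L (1 + log 2^L))`
(cover the interval by `≤ N/2^L + 2` full periods). [cite: Bourgain2013MoebiusWalsh, (3.8)–(3.9), (2.24)] -/
theorem sum_Ico_geomBound_mul_div_le {a : ℕ} (ha : a ≠ 0) (L : ℕ) {V : ℝ} (hV : 0 ≤ V) (β : ℝ)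
    (n₀ N : ℕ) :
    ∑ n ∈ Ico n₀ (n₀ + N), geomBound V (((a * n : ℕ) : ℝ) / 2 ^ L + β) ≤
      ((N : ℝ) / 2 ^ L + 2) * (2 ^ (a.factorization 2 + 1) * V + 2 ^ L * (1 + Real.log (2 ^ L))) := by
  set P : ℕ := 2 ^ L with hP
  have hP0 : 0 < P := Nat.two_pow_pos L
  set t₀ := n₀ / P with ht₀
  set T := N / P + 2 with hT
  set g : ℕ → ℝ := fun n => geomBound V (((a * n : ℕ) : ℝ) / 2 ^ L + β) with hg
  have hg0 : ∀ n, 0 ≤ g n := fun n => geomBound_nonneg hV _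
  -- cover `[n₀, n₀ + N)` by the `T` full periods `[P t₀, P t₀ + P T)`
  have hsub : Ico n₀ (n₀ + N) ⊆ Ico (P * t₀) (P * t₀ + P * T) := by
    intro n hn
    rw [Finset.mem_Ico] at hn ⊢
    have h1 : P * t₀ ≤ n₀ := Nat.mul_div_le n₀ P
    have h2 : n₀ < P * t₀ + P := by rw [ht₀]; have := Nat.lt_mul_div_succ n₀ hP0; linarith
    have h3 : N < P * (N / P) + P := by have := Nat.lt_mul_div_succ N hP0; linarith
    constructor
    · omega
    · rw [hT]; nlinarith
  have hperiod : ∀ u : ℕ, ∑ k ∈ range P, g (P * t₀ + (k + P * u)) ≤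
      2 ^ (a.factorization 2 + 1) * V + 2 ^ L * (1 + Real.log (2 ^ L)) := by
    intro u
    refine le_trans (le_of_eq (Finset.sum_congr rfl fun k _ => ?_)) (sum_range_geomBound_mul_div_le ha L hV β)
    rw [hg]
    dsimp only
    rw [show (((a * (P * t₀ + (k + P * u)) : ℕ) : ℝ) / 2 ^ L + β) =
      (((a * k : ℕ) : ℝ) / 2 ^ L + β) + ((a * (t₀ + u) : ℕ) : ℝ) by rw [hP]; push_cast; field_simp; ring,
      geomBound_add_nat]
  have hB0 : 0 ≤ 2 ^ (a.factorization 2 + 1) * V + 2 ^ L * (1 + Real.log (2 ^ L)) := by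
    have : 0 ≤ Real.log ((2 : ℝ) ^ L) := Real.log_nonneg (one_le_pow₀ (by norm_num))
    positivity
  calc ∑ n ∈ Ico n₀ (n₀ + N), g n ≤ ∑ n ∈ Ico (P * t₀) (P * t₀ + P * T), g n :=
        Finset.sum_le_sum_of_subset_of_nonneg hsub fun n _ _ => hg0 n
    _ = ∑ u ∈ range T, ∑ k ∈ range P, g (P * t₀ + (k + P * u)) := by
        rw [Finset.sum_Ico_eq_sum_range, show P * t₀ + P * T - P * t₀ = P * T by omega,
          sum_range_mul_eq_sum_sum]
    _ ≤ ∑ _u ∈ range T, (2 ^ (a.factorization 2 + 1) * V + 2 ^ L * (1 + Real.log (2 ^ L))) :=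
        Finset.sum_le_sum fun u _ => hperiod u
    _ = (T : ℝ) * (2 ^ (a.factorization 2 + 1) * V + 2 ^ L * (1 + Real.log (2 ^ L))) := by
        rw [Finset.sum_const, Finset.card_range, nsmul_eq_mul]
    _ ≤ ((N : ℝ) / 2 ^ L + 2) * (2 ^ (a.factorization 2 + 1) * V + 2 ^ L * (1 + Real.log (2 ^ L))) := by
        refine mul_le_mul_of_nonneg_right ?_ hB0
        rw [hT]; push_cast
        have : ((N / P : ℕ) : ℝ) ≤ (N : ℝ) / 2 ^ L := by
          have h' := @Nat.cast_div_le ℝ _ _ _ N P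
          rw [hP] at h' ⊢; push_cast at h'; exact h'
        linarith

/-! ### The dyadic average of `τ(a) 2^{v₂(a)}` -/

/-- `τ(2^v) = v + 1`. [folklore] -/
theorem card_divisors_two_pow (v : ℕ) : (2 ^ v).divisors.card = v + 1 := by
  rw [Nat.divisors_prime_pow Nat.prime_two, Finset.card_map, Finset.card_range]

/-- `τ(2^v a') = (v+1) τ(a')` for `a'` odd. [folklore] -/
theorem card_divisors_two_pow_mul_odd (v : ℕ) {a' : ℕ} (ha' : Odd a') :
    (2 ^ v * a').divisors.card = (v + 1) * a'.divisors.card := by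
  rw [Nat.Coprime.card_divisors_mul ((Nat.coprime_two_left.mpr ha').pow_left v), card_divisors_two_pow]

/-- **Dyadic average of `τ(a)2^{v₂(a)}`**:
`∑_{2^i ≤ a < 2^{i+1}} τ(a) 2^{v₂(a)} ≤ (i+1)² 2^{i+1} (1 + log 2^{i+1})` (group by `v₂(a) = s ≤ i`:
`τ(2^s a') = (s+1)τ(a')` and `∑_{c ≤ 2^{i+1-s}} τ(c) ≤ 2^{i+1-s}(1 + log 2^{i+1-s})`). With `τ ≥ 1` it
contains Bourgain's `∑_{m ∼ M} 2^{v₂(m)} ≲ μM` ((3.8)–(3.9)); the divisor weight is the type-I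
coefficient `|μ_u ∗ μ_u| ≤ τ` of the Vaughan decomposition for `μ`. [cite: Bourgain2013MoebiusWalsh, (3.8)–(3.9)] -/
theorem sum_dyadic_card_divisors_mul_two_pow_le (i : ℕ) :
    ∑ a ∈ Ico (2 ^ i) (2 ^ (i + 1)), (a.divisors.card : ℝ) * 2 ^ (a.factorization 2) ≤
      ((i : ℝ) + 1) ^ 2 * 2 ^ (i + 1) * (1 + Real.log (2 ^ (i + 1))) := by
  classical
  set f : ℕ → ℕ → ℝ := fun a s => if 2 ^ s ∣ a then (2 : ℝ) ^ s * ((s : ℝ) + 1) * ((a / 2 ^ s).divisors.card : ℝ) else 0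
    with hf
  have hf0 : ∀ a s, 0 ≤ f a s := fun a s => by
    rw [hf]; dsimp only; split_ifs <;> positivity
  -- pointwise: `τ(a)2^{v(a)}` is the `s = v₂(a)` term
  have hpt : ∀ a ∈ Ico (2 ^ i) (2 ^ (i + 1)),
      (a.divisors.card : ℝ) * 2 ^ (a.factorization 2) ≤ ∑ s ∈ range (i + 1), f a s := by
    intro a ha
    rw [Finset.mem_Ico] at ha
    have ha0 : a ≠ 0 := by have := Nat.one_le_two_pow (n := i); omega
    obtain ⟨a', ha', haeq⟩ := exists_eq_two_pow_factorization_mul_odd ha0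
    set v := a.factorization 2 with hv
    have h2v : 0 < 2 ^ v := Nat.two_pow_pos v
    have hvle : 2 ^ v ≤ a := by
      rw [haeq]; exact Nat.le_mul_of_pos_right _ (Nat.pos_of_ne_zero fun h => by simp [h] at ha')
    have hvi : v ∈ range (i + 1) := by
      rw [Finset.mem_range]
      by_contra hc
      have : 2 ^ (i + 1) ≤ 2 ^ v := Nat.pow_le_pow_right (by norm_num) (by omega)
      omega
    have hdvd : 2 ^ v ∣ a := ⟨a', haeq⟩
    have hdiv : a / 2 ^ v = a' := by rw [haeq, Nat.mul_div_cancel_left _ h2v]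
    refine le_trans (le_of_eq ?_) (Finset.single_le_sum (fun s _ => hf0 a s) hvi)
    rw [hf]; dsimp only
    rw [if_pos hdvd, hdiv, haeq, card_divisors_two_pow_mul_odd v ha']
    push_cast; ring
  -- sum over `a`, swap, and bound each `s`-slice
  have hlog1 : 0 ≤ 1 + Real.log ((2 : ℝ) ^ (i + 1)) := by
    have : 0 ≤ Real.log ((2 : ℝ) ^ (i + 1)) := Real.log_nonneg (one_le_pow₀ (by norm_num)); linarith
  have hslice : ∀ s ∈ range (i + 1), ∑ a ∈ Ico (2 ^ i) (2 ^ (i + 1)), f a s ≤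
      ((i : ℝ) + 1) * 2 ^ (i + 1) * (1 + Real.log (2 ^ (i + 1))) := by
    intro s hs
    rw [Finset.mem_range] at hs
    have h2s : 0 < 2 ^ s := Nat.two_pow_pos s
    rw [hf]; dsimp only
    rw [← Finset.sum_filter, ← Finset.mul_sum]
    -- reindex `a = 2^s c`
    set F := (Ico (2 ^ i) (2 ^ (i + 1))).filter (fun a => 2 ^ s ∣ a) with hF
    have hinj : Set.InjOn (fun a : ℕ => a / 2 ^ s) ↑F := by
      intro a ha b hb hab
      have ha' := (Finset.mem_filter.1 ha).2
      have hb' := (Finset.mem_filter.1 hb).2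
      have h := congrArg (· * 2 ^ s) hab
      simp only [Nat.div_mul_cancel ha', Nat.div_mul_cancel hb'] at h
      exact h
    have himage : F.image (fun a : ℕ => a / 2 ^ s) ⊆ Ioc 0 (2 ^ (i + 1 - s)) := by
      intro c hc
      rw [Finset.mem_image] at hc
      obtain ⟨a, ha, rfl⟩ := hc
      have ha' := Finset.mem_filter.1 ha
      rw [Finset.mem_Ico] at ha'
      rw [Finset.mem_Ioc]
      constructor
      · apply Nat.div_pos _ h2s
        exact le_trans (Nat.pow_le_pow_right (by norm_num) (by omega)) ha'.1.1
      · have hlt : a / 2 ^ s < 2 ^ (i + 1) / 2 ^ s :=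
          Nat.div_lt_div_of_lt_of_dvd (pow_dvd_pow 2 (by omega)) ha'.1.2
        rw [Nat.pow_div (by omega) (by norm_num)] at hlt
        exact hlt.le
    have hsum : ∑ a ∈ F, ((a / 2 ^ s).divisors.card : ℝ) ≤ 2 ^ (i + 1 - s) * (1 + Real.log (2 ^ (i + 1))) := by
      rw [← Finset.sum_image (f := fun c : ℕ => (c.divisors.card : ℝ)) hinj]
      calc ∑ c ∈ F.image (fun a : ℕ => a / 2 ^ s), (c.divisors.card : ℝ)
          ≤ ∑ c ∈ Ioc 0 (2 ^ (i + 1 - s)), (c.divisors.card : ℝ) :=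
            Finset.sum_le_sum_of_subset_of_nonneg himage fun c _ _ => by positivity
        _ ≤ (2 ^ (i + 1 - s) : ℕ) * (1 + Real.log (2 ^ (i + 1 - s) : ℕ)) :=
            Literature.NumberTheory.Sieve.Vaughan.sum_card_divisors_le _
        _ ≤ 2 ^ (i + 1 - s) * (1 + Real.log (2 ^ (i + 1))) := by
            push_cast
            gcongr
            · norm_num
            · omega
    calc (2 : ℝ) ^ s * ((s : ℝ) + 1) * ∑ a ∈ F, ((a / 2 ^ s).divisors.card : ℝ)
        ≤ 2 ^ s * ((s : ℝ) + 1) * (2 ^ (i + 1 - s) * (1 + Real.log (2 ^ (i + 1)))) :=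
          mul_le_mul_of_nonneg_left hsum (by positivity)
      _ = ((s : ℝ) + 1) * 2 ^ (i + 1) * (1 + Real.log (2 ^ (i + 1))) := by
          rw [show (2 : ℝ) ^ (i + 1) = 2 ^ s * 2 ^ (i + 1 - s) by rw [← pow_add]; congr 1; omega]; ring
      _ ≤ ((i : ℝ) + 1) * 2 ^ (i + 1) * (1 + Real.log (2 ^ (i + 1))) := by
          have : (s : ℝ) + 1 ≤ i + 1 := by
            have : (s : ℝ) ≤ i := by exact_mod_cast Nat.lt_succ_iff.1 hs
            linarith
          gcongr
  calc ∑ a ∈ Ico (2 ^ i) (2 ^ (i + 1)), (a.divisors.card : ℝ) * 2 ^ (a.factorization 2)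
      ≤ ∑ a ∈ Ico (2 ^ i) (2 ^ (i + 1)), ∑ s ∈ range (i + 1), f a s := Finset.sum_le_sum hpt
    _ = ∑ s ∈ range (i + 1), ∑ a ∈ Ico (2 ^ i) (2 ^ (i + 1)), f a s := Finset.sum_comm
    _ ≤ ∑ _s ∈ range (i + 1), ((i : ℝ) + 1) * 2 ^ (i + 1) * (1 + Real.log (2 ^ (i + 1))) :=
        Finset.sum_le_sum hslice
    _ = ((i : ℝ) + 1) ^ 2 * 2 ^ (i + 1) * (1 + Real.log (2 ^ (i + 1))) := by
        rw [Finset.sum_const, Finset.card_range, nsmul_eq_mul]; push_cast; ring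

/-! ### Geometric sums over a block, in the `eChar` normal form of `MoebiusWalshCircuitsProofs` -/

/-- `|∑_{B₀ ≤ b < B₀+N} e(θb)| ≤ min(N, 1/(2‖θ‖))` (Nathanson, Lemma 4.7, for a shifted block).
[folklore] -/
theorem norm_sum_Ico_eChar_le_geomBound (θ : ℝ) (B₀ N : ℕ) :
    ‖∑ b ∈ Ico B₀ (B₀ + N), eChar (θ * b)‖ ≤ geomBound N θ := by
  have hshift : ∑ b ∈ Ico B₀ (B₀ + N), eChar (θ * b) = eChar (θ * B₀) * ∑ n ∈ range N, eChar (θ * n) := by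
    rw [Finset.sum_Ico_eq_sum_range, show B₀ + N - B₀ = N by omega, Finset.mul_sum]
    refine Finset.sum_congr rfl fun n _ => ?_
    rw [← eChar_add]; congr 1; push_cast; ring
  have hIoc : ∑ n ∈ Ioc 0 N, (Real.fourierChar ((n : ℝ) * θ) : ℂ) = eChar θ * ∑ n ∈ range N, eChar (θ * n) := by
    have h1 : Ioc 0 N = Ico (0 + 1) (0 + N + 1) := by ext n; simp only [Finset.mem_Ioc, Finset.mem_Ico]; omega
    rw [h1, Finset.sum_Ico_eq_sum_range, show 0 + N + 1 - (0 + 1) = N by omega, Finset.mul_sum]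
    refine Finset.sum_congr rfl fun n _ => ?_
    rw [← eChar_eq_fourierChar, ← eChar_add]; congr 1; push_cast; ring
  have hnorm : ‖∑ b ∈ Ico B₀ (B₀ + N), eChar (θ * b)‖ = ‖∑ n ∈ Ioc 0 N, (Real.fourierChar ((n : ℝ) * θ) : ℂ)‖ := by
    rw [hshift, hIoc, norm_mul, norm_mul, norm_eChar, norm_eChar]
  rw [hnorm]
  exact Literature.NumberTheory.Sieve.Vinogradov.norm_sum_Ioc_fourierChar_le_geomBound θ (by simp)

end Literature.NumberTheory.LFunctions.MoebiusWalsh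

end
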